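import Literature.RingTheory.Length.Semilocal
import Literature.RingTheory.Length.OrdFiniteExtension
import Mathlib.RingTheory.HopkinsLevitzki
import Mathlib.RingTheory.Localization.Ideal
import Mathlib.Algebra.Module.LocalizedModule.IsLocalization
import Mathlib.RingTheory.Ideal.Quotient.Operations
import HarnessLib

/-!
# Route `RadicialJung`, crux `CleanModels` (stmt-15917): one point's weighted colength is bounded
# by the weighted total

Support file (OURS; general commutative algebra) for PROGRAMME-clean-dim2 (K2/K4, W8.1): the
per-point reading of the `R`-lengths in Giraud's Lemme 2.1.1
(`RadicialJungCleanModelsGiraudTotalColength.lean`). For an `R`-algebra `S` (a chart ring of a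
blowing up, `R = 𝒪_{X,ξ}`), an ideal `W ⊆ S` with `S/W` of finite length (the weak transform) and a
maximal ideal `Q ⊇ W` of `S` (a closed point `ξ′` of the chart with `W ⊆ Q`), Fulton's
Lemmas A.1.2–A.1.3 (`Literature.RingTheory.Length.length_eq_finsum_length_localizedModule`,
applied to the Artinian ring `B = S/W`) give
`λ_R(S/W) = Σ_{𝔪 ∈ Max B} λ_R(B/𝔪) · λ_B(B_𝔪)`; here we extract ONE term:

* `isMaximal_map_quotient_mk` — `Q·(S/W)` is a maximal ideal of `B = S/W` for `W ⊆ Q` maximal;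
* `length_quotient_mul_length_localized_le` — **`λ_R(S/Q) · λ_B(B_{𝔪_Q}) ≤ λ_R(S/W)`**, where
  `𝔪_Q = Q·B` and `B_{𝔪_Q} = (S/W)_Q` is the local ring of the subscheme `V(W)` at the point `Q`
  (`λ_R(S/Q) = [κ(Q) : κ(R)]` when `R` is local with `Q` over its maximal ideal, and `λ_B(B_{𝔪_Q})`
  is the colength `c(ξ′)` of `W` at `ξ′`): Giraud's weighted term `[k(ξ′):k(ξ)]·c(I′, ξ′)` of ONE
  point is at most the weighted total;
* `length_localized_quotient_eq_length_quotient_map`, `length_quotient_mul_length_atPrime_le` —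
  the same with the local term written `λ_T(T/WT)` for any localization `T = S_Q` (the local
  ring `𝒪_{X′,ξ′}` of the blown-up surface at `ξ′`).

References: W. Fulton, *Intersection Theory*, App. A.1, Lemmas A.1.2–A.1.3 [Fulton1998];
J. Giraud, Bull. SMF 111 (1983), Lemme 2.1.1 [Giraud1983]. Nothing here is a statement of
Hironaka's manuscript or bears on the summit directly.
-/

noncomputable section

set_option linter.dupNamespace false -- mandated namespace of this single-conjunct summit

namespace Summit.ResolutionOfSingularities.ResolutionOfSingularities.Theorems.RadicialJung.CleanModels

universe u v

variable {R : Type u} [CommRing R] {S : Type v} [CommRing S] [Algebra R S]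

/-- For a maximal ideal `Q ⊇ W`, the image `Q·(S/W)` is a maximal ideal of `S/W`. [folklore] -/
theorem isMaximal_map_quotient_mk {W Q : Ideal S} [hQ : Q.IsMaximal] (hWQ : W ≤ Q) :
    (Q.map (Ideal.Quotient.mk W)).IsMaximal := by
  rcases Ideal.map_eq_top_or_isMaximal_of_surjective (Ideal.Quotient.mk W)
    Ideal.Quotient.mk_surjective hQ with h | h
  · exfalso
    apply hQ.ne_top
    have := Ideal.comap_map_of_surjective (Ideal.Quotient.mk W) Ideal.Quotient.mk_surjective Q
    rw [h, Ideal.comap_top] at this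
    refine top_le_iff.mp ?_
    rw [this]
    refine sup_le le_rfl fun s hs => hWQ ?_
    rwa [Ideal.mem_comap, Ideal.mem_bot, Ideal.Quotient.eq_zero_iff_mem] at hs
  · exact h

/-- **One point's weighted colength is at most the weighted total** (Fulton, App. A.1,
Lemmas A.1.2–A.1.3, one term of the sum). For an `R`-algebra `S`, an ideal `W` with `S/W` of
finite length, and a maximal ideal `Q ⊇ W` of `S`, with `B = S/W` and `𝔪_Q = Q·B` (maximal:
supply the instance by `isMaximal_map_quotient_mk`):
`λ_R(S/Q) · λ_B(B_{𝔪_Q}) ≤ λ_R(S/W)` (`B_{𝔪_Q} = (S/W)_Q`; `λ_R(S/Q)` is the residue degree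
`[κ(Q):κ]` when `R` is local under `Q`). [cite: Fulton1998, Lemma A.1.3] -/
theorem length_quotient_mul_length_localized_le (W Q : Ideal S) (hWQ : W ≤ Q)
    [hmax : (Q.map (Ideal.Quotient.mk W)).IsMaximal] (hfin : IsFiniteLength S (S ⧸ W)) :
    Module.length R (S ⧸ Q) *
        Module.length (S ⧸ W) (LocalizedModule
          (Q.map (Ideal.Quotient.mk W)).primeCompl (S ⧸ W)) ≤
      Module.length R (S ⧸ W) := by
  -- `B = S/W` is an Artinian ring
  have hfinB : IsFiniteLength (S ⧸ W) (S ⧸ W) := by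
    rw [← Module.length_ne_top_iff] at hfin ⊢
    rwa [← Module.length_eq_of_surjective (S := S) (R := S ⧸ W) (M := S ⧸ W)
      Ideal.Quotient.mk_surjective]
  haveI : IsArtinianRing (S ⧸ W) := by
    rw [isFiniteLength_iff_isNoetherian_isArtinian] at hfinB
    exact hfinB.2
  let 𝔪 : MaximalSpectrum (S ⧸ W) := ⟨Q.map (Ideal.Quotient.mk W), hmax⟩
  have hsum := Literature.RingTheory.Length.length_eq_finsum_length_localizedModule
    (A := R) (B := S ⧸ W) (S ⧸ W) hfinB
  -- one term of the sum
  have hle : Module.length R ((S ⧸ W) ⧸ 𝔪.asIdeal) *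
      Module.length (S ⧸ W) (LocalizedModule 𝔪.asIdeal.primeCompl (S ⧸ W)) ≤
      Module.length R (S ⧸ W) := by
    rw [hsum]
    exact single_le_finsum 𝔪 (Set.toFinite _) fun _ => bot_le (α := ℕ∞)
  -- `λ_R(B/𝔪_Q) = λ_R(S/Q)`
  have e : ((S ⧸ W) ⧸ 𝔪.asIdeal) ≃ₗ[R] S ⧸ Q :=
    (DoubleQuot.quotQuotEquivQuotOfLEₐ R hWQ).toLinearEquiv
  rw [e.length_eq] at hle
  exact hle

/-- The image in `S/W` of the complement of a prime `Q ⊇ W` is the complement of `Q·(S/W)`.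
[folklore] -/
theorem algebraMapSubmonoid_quotient_primeCompl {W Q : Ideal S} [Q.IsPrime] (hWQ : W ≤ Q)
    [(Q.map (Ideal.Quotient.mk W)).IsPrime] :
    Algebra.algebraMapSubmonoid (S ⧸ W) Q.primeCompl = (Q.map (Ideal.Quotient.mk W)).primeCompl := by
  have hmem : ∀ s : S, Ideal.Quotient.mk W s ∈ Q.map (Ideal.Quotient.mk W) ↔ s ∈ Q := by
    intro s
    rw [Ideal.mem_map_iff_of_surjective _ Ideal.Quotient.mk_surjective]
    constructor
    · rintro ⟨q, hq, hqs⟩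
      rw [Ideal.Quotient.eq] at hqs
      have : s = q - (q - s) := by ring
      rw [this]
      exact sub_mem hq (hWQ hqs)
    · exact fun hs => ⟨s, hs, rfl⟩
  ext t
  constructor
  · rintro ⟨s, hs, rfl⟩
    exact fun ht => hs ((hmem s).mp ht)
  · intro ht
    obtain ⟨s, rfl⟩ := Ideal.Quotient.mk_surjective t
    exact ⟨s, fun hs => ht ((hmem s).mpr hs), rfl⟩

/-- **The local term is the colength in the local ring at the point.** With `B = S/W`,
`𝔪_Q = Q·B` and `T = S_Q` any localization of `S` at the prime `Q ⊇ W`: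
`λ_B(B_{𝔪_Q}) = λ_T(T/WT)` (`T/WT` is the localization of `B` at `𝔪_Q`, and lengths over `B` and
over the localization at a maximal ideal agree, Fulton A.1.3 with residue degree `1`).
[cite: Fulton1998, Lemma A.1.3] -/
theorem length_localized_quotient_eq_length_quotient_map (W Q : Ideal S) [Q.IsPrime]
    (hWQ : W ≤ Q) [hmax : (Q.map (Ideal.Quotient.mk W)).IsMaximal] (T : Type v) [CommRing T]
    [Algebra S T] [IsLocalization.AtPrime T Q] :
    Module.length (S ⧸ W) (LocalizedModule (Q.map (Ideal.Quotient.mk W)).primeCompl (S ⧸ W)) =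
      Module.length T (T ⧸ W.map (algebraMap S T)) := by
  set L := T ⧸ W.map (algebraMap S T)
  -- `L` is the localization of `B = S/W` at `𝔪_Q`
  haveI hloc : IsLocalization.AtPrime L (Q.map (Ideal.Quotient.mk W)) := by
    have h : IsLocalization (Algebra.algebraMapSubmonoid (S ⧸ W) Q.primeCompl) L := inferInstance
    rwa [algebraMapSubmonoid_quotient_primeCompl hWQ] at h
  haveI : IsLocalRing L :=
    IsLocalization.AtPrime.isLocalRing L (Q.map (Ideal.Quotient.mk W))
  have e := IsLocalizedModule.iso (Q.map (Ideal.Quotient.mk W)).primeCompl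
    (Algebra.linearMap (S ⧸ W) L)
  rw [e.length_eq, Literature.RingTheory.Length.length_eq_length_of_isLocalization_atPrime
    (Q.map (Ideal.Quotient.mk W)) L L,
    Module.length_eq_of_surjective (S := T) (R := L) (M := L) Ideal.Quotient.mk_surjective]

/-- **One point's weighted colength, in local-ring form**: for `T = S_Q` (any localization at
the maximal ideal `Q ⊇ W`), `λ_R(S/Q) · λ_T(T/WT) ≤ λ_R(S/W)` — Giraud's term
`[k(ξ′):k(ξ)]·c(I′,ξ′)` with `c(I′,ξ′) = λ(𝒪_{X′,ξ′}/I′)` is at most the weighted total over the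
chart. [cite: Fulton1998, Lemma A.1.3] -/
theorem length_quotient_mul_length_atPrime_le (W Q : Ideal S) [Q.IsMaximal] (hWQ : W ≤ Q)
    (hfin : IsFiniteLength S (S ⧸ W)) (T : Type v) [CommRing T] [Algebra S T]
    [IsLocalization.AtPrime T Q] :
    Module.length R (S ⧸ Q) * Module.length T (T ⧸ W.map (algebraMap S T)) ≤
      Module.length R (S ⧸ W) := by
  haveI := isMaximal_map_quotient_mk (W := W) (Q := Q) hWQ
  rw [← length_localized_quotient_eq_length_quotient_map W Q hWQ T]
  exact length_quotient_mul_length_localized_le W Q hWQ hfin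

end Summit.ResolutionOfSingularities.ResolutionOfSingularities.Theorems.RadicialJung.CleanModels

end
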